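import Summits.QuantumFields.YangMills.Theorems.SourcedPressureJensenSourcedPressureDecouplingDefs
import Summits.QuantumFields.YangMills.Theorems.SourcedPressureJensenColdBoxSourcedPressureDefs
import Summits.QuantumFields.YangMills.Theorems.SourcedPressureJensenSourcedPressureDecouplingHolderAverage
import HarnessLib

/-!
# Route `SourcedPressureJensen`, crux `SourcedPressureDecoupling` (KS2″, stmt-QuantumFields-24296), line «ENTROPIC-SEAM»,
# stub `stub_chain` — part 1: the free-cell increment in the KS1″ objects, its SUBLINEARITY in the source strength,
# and SEAM REMOVAL

Three bricks of the registered `stub_chain` (decoupling chain), in the objects of `…SourcedPressureDecouplingDefs` (KS2″) and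
`…ColdBoxSourcedPressureDefs` (KS1″):

* `freeCell_eq_log_integral` — the KS2″ free-cell increment IS the KS1″ free-cell state integral:
  `freeCell r β t m n ℓ L = ((ℓ+1)⁴)⁻¹ · log ∫ exp(−t·cellSource r β m ℓ n L) d(freeCellState r β ℓ L)` (`ratio_eq_integral_freeCellState`);
* `freeCell_le_div_mul_freeCell` — SUBLINEARITY in the source strength: `freeCell(t) ≤ (t/t′)·freeCell(t′)` for `0 ≤ t ≤ t′`, `0 < t′`
  (convexity of `s ↦ log E_ν e^{−sX}` with value `0` at `s = 0`: finite Hölder `log_integral_exp_sum_mul_le` on the probability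
  measure `freeCellState`);
* `log_wilsonExpectation_le_log_tilted_add` — SEAM REMOVAL: for continuous `F > 0`-valued `e^{f}` and a continuous `W ≥ 0`,
  `log E_T[e^{f}] ≤ log ∫ e^{f} d(μ_T.tilted W) + log E_T[e^{W}]` (since `e^{−W} ≤ 1`; `μ_T = E_T[e^W]·e^{−W}·(μ_T.tilted W)`).

Everything is proved; no definition, no named fact.  RECORD-label rung support (route target `XiPow` = an upper bound on the lattice gap);
the Yang–Mills mass gap is NOT proved by anything here. [folklore]
-/

set_option autoImplicit false

noncomputable section

open MeasureTheory Real Finset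
open Literature.MathematicalPhysics.QuantumFieldTheory Literature.MathematicalPhysics.QuantumLattice
open Summit.QuantumFields.YangMills.Theorems.WeakCouplingRates
open Summit.QuantumFields.YangMills.Cruxes.ColdBoxSourcedPressure.Birth
open Summit.QuantumFields.YangMills.Theorems.SourcedPressureJensen

namespace Summit.QuantumFields.YangMills.Cruxes.SourcedPressureDecoupling.EntropicSeam

variable {G : Type} [Group G] [TopologicalSpace G] [IsTopologicalGroup G] [CompactSpace G]
  [MeasurableSpace G] [BorelSpace G]

/-! ### The free-cell increment in the KS1″ objects -/

/-- **`freeCell` is a free-cell-state log-moment**: `freeCell r β t m n ℓ L = ((ℓ+1)⁴)⁻¹ · log ∫ e^{−t·cellSource} dν`,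
`ν = freeCellState r β ℓ L` (the KS2″ and KS1″ skeletons write the same sub-expressions). [folklore] -/
theorem freeCell_eq_log_integral (r : LatticeRep G) (β t m : ℝ) (n ℓ L : ℕ) :
    freeCell r β t m n ℓ L =
      ((ℓ + 1 : ℝ) ^ 4)⁻¹ * Real.log (∫ U, Real.exp (-t * cellSource r β m ℓ n L U) ∂(freeCellState r β ℓ L)) := by
  rw [← ratio_eq_integral_freeCellState r β ℓ L (fun U => Real.exp (-t * cellSource r β m ℓ n L U))]
  rfl

/-! ### Sublinearity in the source strength -/

/-- Convexity of a log-moment generating function at the origin: for a probability measure `ν`, a real `X` with `e^{−t′X}`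
integrable and `0 ≤ t ≤ t′`, `0 < t′`: `log ∫ e^{−tX} dν ≤ (t/t′) · log ∫ e^{−t′X} dν` (finite Hölder with weights `t/t′`,
`1 − t/t′` and the second function `0`). [folklore] -/
theorem log_integral_exp_neg_mul_le_div_mul {α : Type*} [MeasurableSpace α] {ν : Measure α} [IsProbabilityMeasure ν]
    (X : α → ℝ) {t t' : ℝ} (ht : 0 ≤ t) (htt' : t ≤ t') (ht' : 0 < t')
    (hint : Integrable (fun x => Real.exp (-t' * X x)) ν) :
    Real.log (∫ x, Real.exp (-t * X x) ∂ν) ≤ (t / t') * Real.log (∫ x, Real.exp (-t' * X x) ∂ν) := by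
  -- weights `w₀ = t/t'`, `w₁ = 1 − t/t'` on the two functions `−t'X` and `0`
  have hw0 : 0 ≤ t / t' := div_nonneg ht ht'.le
  have hw1 : 0 ≤ 1 - t / t' := by rw [sub_nonneg, div_le_one ht']; exact htt'
  have h := log_integral_exp_sum_mul_le (μ := ν) (Finset.univ : Finset (Fin 2)) ![t / t', 1 - t / t']
    ![fun x => -t' * X x, fun _ => 0]
    (fun i _ => by fin_cases i <;> simp [hw0, hw1])
    (by simp [Fin.sum_univ_two])
    (fun i _ => by
      fin_cases i
      · simpa using hint
      · simp)
  have hsum : ∀ x, ∑ i : Fin 2, (![t / t', 1 - t / t'] i) * (![fun x => -t' * X x, fun _ => (0 : ℝ)] i) x = -t * X x := by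
    intro x
    simp [Fin.sum_univ_two]
    field_simp
  simp only [hsum, Fin.sum_univ_two, Matrix.cons_val_zero, Matrix.cons_val_one] at h
  simpa using h

/-- **Sublinearity of the free-cell increment in the source strength**: for `0 ≤ t ≤ t′`, `0 < t′`,
`freeCell r β t m n ℓ L ≤ (t/t′) · freeCell r β t′ m n ℓ L`. [folklore] -/
theorem freeCell_le_div_mul_freeCell (r : LatticeRep G) (β m : ℝ) (n ℓ L : ℕ) {t t' : ℝ} (ht : 0 ≤ t)
    (htt' : t ≤ t') (ht' : 0 < t') :
    freeCell r β t m n ℓ L ≤ (t / t') * freeCell r β t' m n ℓ L := by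
  haveI := isProbabilityMeasure_freeCellState r β ℓ L
  haveI := r.secondCountableTopology
  have hint : Integrable (fun U => Real.exp (-t' * cellSource r β m ℓ n L U)) (freeCellState r β ℓ L) :=
    (Real.continuous_exp.comp (continuous_const.mul (continuous_cellSource r β m ℓ n L))).integrable_of_hasCompactSupport
      (HasCompactSupport.of_compactSpace _)
  have h := log_integral_exp_neg_mul_le_div_mul (ν := freeCellState r β ℓ L) (cellSource r β m ℓ n L) ht htt' ht' hint
  rw [freeCell_eq_log_integral, freeCell_eq_log_integral]
  have hV : 0 ≤ ((ℓ + 1 : ℝ) ^ 4)⁻¹ := by positivity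
  calc ((ℓ + 1 : ℝ) ^ 4)⁻¹ * Real.log (∫ U, Real.exp (-t * cellSource r β m ℓ n L U) ∂freeCellState r β ℓ L)
      ≤ ((ℓ + 1 : ℝ) ^ 4)⁻¹ * ((t / t') * Real.log (∫ U, Real.exp (-t' * cellSource r β m ℓ n L U) ∂freeCellState r β ℓ L)) :=
        mul_le_mul_of_nonneg_left h hV
    _ = (t / t') * (((ℓ + 1 : ℝ) ^ 4)⁻¹ *
          Real.log (∫ U, Real.exp (-t' * cellSource r β m ℓ n L U) ∂freeCellState r β ℓ L)) := by ring

/-! ### Seam removal -/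

/-- **Seam removal** (any reference tilt by a nonnegative weight): for the torus Wilson state `μ_T`, continuous `f` and a continuous
`W ≥ 0`: `log E_T[e^{f}] ≤ log ∫ e^{f} d(μ_T.tilted W) + log E_T[e^{W}]` — because `E_T[e^f] = E_T[e^W]·∫ e^{f} e^{−W} d(μ_T.tilted W)`
and `e^{−W} ≤ 1`.  With `W = β·S_seam` the second term is `|T|·seamMoment`. [folklore] -/
theorem log_wilsonExpectation_le_log_tilted_add (r : LatticeRep G) (β : ℝ) {L : ℕ} [NeZero L]
    {f W : GaugeConfig 4 L G → ℝ} (hf : Continuous f) (hW : Continuous W) (hW0 : ∀ U, 0 ≤ W U) :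
    Real.log (wilsonExpectation r.ρ β fun U => Real.exp (f U)) ≤
      Real.log (∫ U, Real.exp (f U) ∂((wilsonMeasure (d := 4) (L := L) r.ρ β).tilted W)) +
        Real.log (wilsonExpectation r.ρ β fun U => Real.exp (W U)) := by
  haveI := isProbabilityMeasure_wilsonMeasure (d := 4) (L := L) (G := G) r.ρ r.continuous β
  haveI := r.secondCountableTopology
  have hintW : Integrable (fun U => Real.exp (W U)) (wilsonMeasure (d := 4) (L := L) r.ρ β) :=
    (Real.continuous_exp.comp hW).integrable_of_hasCompactSupport (HasCompactSupport.of_compactSpace _)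
  have hintf : Integrable (fun U => Real.exp (f U)) (wilsonMeasure (d := 4) (L := L) r.ρ β) :=
    (Real.continuous_exp.comp hf).integrable_of_hasCompactSupport (HasCompactSupport.of_compactSpace _)
  haveI := isProbabilityMeasure_tilted (μ := wilsonMeasure (d := 4) (L := L) r.ρ β) hintW
  have hZW : 0 < wilsonExpectation r.ρ β (fun U => Real.exp (W U)) := by
    unfold wilsonExpectation; exact integral_exp_pos hintW
  have hZf : 0 < wilsonExpectation r.ρ β (fun U => Real.exp (f U)) := by
    unfold wilsonExpectation; exact integral_exp_pos hintf
  -- `∫ e^f e^{-W} dμ_W = E_T[e^f] / E_T[e^W]`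
  have hkey : ∫ U, Real.exp (f U) * Real.exp (-W U) ∂((wilsonMeasure (d := 4) (L := L) r.ρ β).tilted W) =
      wilsonExpectation r.ρ β (fun U => Real.exp (f U)) / wilsonExpectation r.ρ β (fun U => Real.exp (W U)) := by
    rw [← wilsonExpectation_mul_exp_div_eq_integral_tilted]
    congr 1
    unfold wilsonExpectation
    refine integral_congr_ae (ae_of_all _ fun U => ?_)
    simp only
    rw [mul_assoc, ← Real.exp_add, neg_add_cancel, Real.exp_zero, mul_one]
  -- `∫ e^f e^{-W} dμ_W ≤ ∫ e^f dμ_W`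
  have hintfW : Integrable (fun U => Real.exp (f U)) ((wilsonMeasure (d := 4) (L := L) r.ρ β).tilted W) := by
    rw [integrable_tilted_iff hintW]
    exact ((Real.continuous_exp.comp hW).mul (Real.continuous_exp.comp hf)).integrable_of_hasCompactSupport
      (HasCompactSupport.of_compactSpace _) |>.congr (ae_of_all _ fun U => by simp [smul_eq_mul])
  have hle : ∫ U, Real.exp (f U) * Real.exp (-W U) ∂((wilsonMeasure (d := 4) (L := L) r.ρ β).tilted W) ≤
      ∫ U, Real.exp (f U) ∂((wilsonMeasure (d := 4) (L := L) r.ρ β).tilted W) := by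
    refine integral_mono_of_nonneg (ae_of_all _ fun U => by positivity) hintfW (ae_of_all _ fun U => ?_)
    have h1 : Real.exp (-W U) ≤ 1 := Real.exp_le_one_iff.2 (by linarith [hW0 U])
    calc Real.exp (f U) * Real.exp (-W U) ≤ Real.exp (f U) * 1 :=
          mul_le_mul_of_nonneg_left h1 (Real.exp_pos _).le
      _ = Real.exp (f U) := mul_one _
  rw [hkey] at hle
  have hpos : 0 < ∫ U, Real.exp (f U) ∂((wilsonMeasure (d := 4) (L := L) r.ρ β).tilted W) :=
    lt_of_lt_of_le (div_pos hZf hZW) hle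
  have hlog := Real.log_le_log (div_pos hZf hZW) hle
  rw [Real.log_div hZf.ne' hZW.ne'] at hlog
  linarith

end Summit.QuantumFields.YangMills.Cruxes.SourcedPressureDecoupling.EntropicSeam

end
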